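import Literature.Analysis.FluidPDE.KochTataruKernelFourier
import Literature.Analysis.FluidPDE.KochTataruPointwise
import HarnessLib

/-!
# Fourier transforms of the slices of `B(u, v)` and of heat potentials

Analysis/FluidPDE proof companion of `Literature/Analysis/FluidPDE/KochTataru.lean` and
`KochTataruCarleson.lean` (the near-part `L²` estimate `kochTataruBilinear_nearCarleson`,
Koch–Tataru, Adv. Math. 157 (2001), (13), the last unproved ingredient of the bilinear estimate
(L1)). Koch–Tataru prove (13) on the Fourier side in `x` (Steps 3–5: the multipliers
`A_t = a(t^{1/2}D_x)`, `S(-t)A_t`, and the energy computation (16)–(17) for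
`v(t) = ∇S(t)∫₀ᵗ w(s) ds`). For the tree's explicit operator `B(u, v) = kochTataruBilinear u v` the
two objects of that computation are the `x`-Fourier transforms of the time slices of `B(u, v)`
and of the heat potential `Vg(s) = ∫₀ˢ e^{(s-σ)Δ} g(σ) dσ`; this file computes both
(everything **proved**):

* `fourier_inner_kochTataruBilinear_slice`: for `t > 0` and fields `u`, `v` measurable on
  `(0, ∞) × E` with finite Koch–Tataru norms whose tensor has an integrable parabolic majorant,
  `∫_{(0,t) × E} (t-s)^{-1/2} |u(s,y)| |v(s,y)| d(s,y) < ∞` (the `L¹(E)`-size of `B(u,v)(t)`;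
  satisfied by bounded fields supported away from `s = 0` in a bounded set, to which the general
  case reduces by truncation),
  `𝓕_x ⟪B(u,v)(t), w₀⟫ (ξ) = ∫_{(0,t) × E} e^{-2πi⟪y,ξ⟫} 2πi ⟪ξ, u(s,y)⟫ e^{-(2π)²(t-s)|ξ|²} ⟪P(ξ)v(s,y), w₀⟫ d(s,y)`
  (`P(ξ) = leraySymbol ξ`; the kernel symbol of `KochTataruKernelFourier.lean`, Fubini over
  `E × ((0,t) × E)` — `integrable_oseenKernel_prod`, from the `L¹` size (14) of the kernel — and
  translation `fourier_comp_sub_right`); `integrable_kochTataruBilinear_slice`: such slices are in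
  `L¹(E)`;
* `fourier_heatPotential_slice`: for `g` integrable on `(0, s) × E`,
  `𝓕_x (∫_{(0,s) × E} G_{s-σ}(x-y) g(σ,y) d(σ,y)) (ξ) = ∫_{(0,s) × E} e^{-2πi⟪y,ξ⟫} e^{-(2π)²(s-σ)|ξ|²} g(σ,y) d(σ,y)`,
  i.e. `𝓕_x(Vg)(s, ξ) = ∫₀ˢ e^{-(2π)²(s-σ)|ξ|²} ĝ(σ, ξ) dσ` is the damped primitive of
  `KochTataruEnergy.lean` (`integrable_heatKernel_mul_prod`: Tonelli and `∫ G_τ = 1`).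

## Mathlib / tree search

Tree: `fourier_inner_oseenKernel_eq_leraySymbol` (`KochTataruKernelFourier`),
`UnboundedOperators.fourierIntegral_heatKernel_holds`, `lintegral_enorm_heatKernel`,
`exists_lintegral_enorm_oseenKernel_le`, `measurable_heatKernel_uncurry` (`KochTataruKernel`),
`integrable_oseenKernel_duhamel`, `AEMeasurable.oseenKernel_comp` (`KochTataruPointwise`),
`FluidPDE.volume_restrict_prod_univ_eq_prod`. Mathlib: `VectorFourier.fourierIntegral_comp_add_right`,
`Real.fourier_eq`, `integral_integral_swap`, `Integrable.integral_prod_left`, `Integrable.prod_right_ae`,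
`lintegral_prod_symm`, `lintegral_sub_right_eq_self`, `integral_inner`, `Circle.smul_def`,
`Circle.norm_smul`. Nothing is duplicated (`lean search 'fourier_comp_sub_right|kochTataruBilinear_slice|heatPotential'`).

## References

* H. Koch, D. Tataru, *Well-posedness for the Navier–Stokes equations*, Adv. Math. 157 (2001)
  22–35, §2 ((6)–(8)), §3 ((11), (14), Steps 3–4 (16)). Bib key `KochTataruAdvMath2001`
  (held: doi:10.1006/aima.2000.1937, pp. 5–8 of the preprint).
-/

noncomputable section

open MeasureTheory Set Function Filter Topology Metric Real
open scoped ENNReal NNReal RealInnerProductSpace FourierTransform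

namespace Literature.Analysis.FluidPDE

open UnboundedOperators (heatKernel heatSymbol)

variable {E : Type*} [NormedAddCommGroup E] [InnerProductSpace ℝ E] [FiniteDimensional ℝ E]
  [MeasurableSpace E] [BorelSpace E]

/-! ## Translation and the Fourier transform -/

section Translation

/-- Fourier transform of a translate: `𝓕 (x ↦ f(x - y)) (ξ) = e^{-2πi⟪y, ξ⟫} 𝓕 f (ξ)`. [folklore] -/
theorem fourier_comp_sub_right {F : Type*} [NormedAddCommGroup F] [NormedSpace ℂ F]
    (f : E → F) (y ξ : E) :
    𝓕 (fun x => f (x - y)) ξ = 𝐞 (-⟪y, ξ⟫) • 𝓕 f ξ := by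
  have h := VectorFourier.fourierIntegral_comp_add_right 𝐞 (volume : Measure E) (innerₗ E) f (-y)
  have hfun : (f ∘ fun v => v + -y) = fun x => f (x - y) := by
    funext x; simp [sub_eq_add_neg]
  rw [hfun] at h
  have h' := congrFun h ξ
  simp only [innerₗ_apply_apply, inner_neg_left] at h'
  exact h'

/-- Fourier transform of a translated Gaussian: `𝓕 (x ↦ G_τ(x - y)) (ξ) = e^{-2πi⟪y,ξ⟫} e^{-(2π)²τ‖ξ‖²}`
(`τ > 0`). [folklore] -/
theorem fourier_heatKernel_comp_sub {τ : ℝ} (hτ : 0 < τ) (y ξ : E) :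
    𝓕 (fun x => (heatKernel τ (x - y) : ℂ)) ξ = 𝐞 (-⟪y, ξ⟫) • (heatSymbol τ ξ : ℂ) := by
  rw [fourier_comp_sub_right (fun x => (heatKernel τ x : ℂ)) y ξ,
    UnboundedOperators.fourierIntegral_heatKernel_holds hτ ξ]

/-- Fourier transform of a translated kernel entry:
`𝓕 (x ↦ ⟪K(τ, x - y)[a, b], w⟫) (ξ) = e^{-2πi⟪y,ξ⟫} · 2πi ⟪ξ, a⟫ e^{-(2π)²τ‖ξ‖²} ⟪P(ξ)b, w⟫` (`τ > 0`).
[cite: KochTataruAdvMath2001, §2 (6)–(8)] -/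
theorem fourier_inner_oseenKernel_comp_sub {τ : ℝ} (hτ : 0 < τ) (y a b w ξ : E) :
    𝓕 (fun x => ((⟪oseenKernel τ (x - y) a b, w⟫ : ℝ) : ℂ)) ξ =
      𝐞 (-⟪y, ξ⟫) • (2 * π * Complex.I * (⟪ξ, a⟫ : ℝ) * (heatSymbol τ ξ : ℝ) *
        (⟪leraySymbol ξ b, w⟫ : ℝ)) := by
  rw [fourier_comp_sub_right (fun x => ((⟪oseenKernel τ x a b, w⟫ : ℝ) : ℂ)) y ξ,
    fourier_inner_oseenKernel_eq_leraySymbol hτ a b w ξ]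

end Translation

/-! ## The kernel integrand of `B(u, v)(t)` is jointly integrable in `(x, (s, y))` -/

section JointIntegrability

/-- **Joint integrability of the kernel integrand in `(x, (s, y))`.** For fields `u`, `v`
measurable on `(0, ∞) × E` satisfying the `L¹`-majorant condition
`∫_{(0,t) × E} (t-s)^{-1/2} ‖u(s,y)‖ ‖v(s,y)‖ d(s,y) < ∞` (true e.g. for bounded fields supported in
a slab away from `s = 0` and a bounded set in `y`), the integrand
`(x, (s, y)) ↦ K(t-s, x-y)[u(s,y), v(s,y)]` is integrable on `E × ((0,t) × E)`: by Tonelli and the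
`L¹` size of the kernel, `∫ ‖K(τ, z)[a,b]‖ dz ≤ C τ^{-1/2} ‖a‖ ‖b‖` (Koch–Tataru 2001, (14);
`exists_lintegral_enorm_oseenKernel_le`). [cite: KochTataruAdvMath2001, §3 (14)] -/
theorem integrable_oseenKernel_prod {u v : ℝ → E → E}
    (hu : AEStronglyMeasurable (uncurry u) ((volume : Measure (ℝ × E)).restrict (Ioi 0 ×ˢ univ)))
    (hv : AEStronglyMeasurable (uncurry v) ((volume : Measure (ℝ × E)).restrict (Ioi 0 ×ˢ univ)))
    {t : ℝ}
    (hL1 : ∫⁻ p in Ioo 0 t ×ˢ univ, ENNReal.ofReal ((t - p.1) ^ (-(1 / 2 : ℝ))) *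
      (‖u p.1 p.2‖ₑ * ‖v p.1 p.2‖ₑ) ∂(volume : Measure (ℝ × E)) < ∞) :
    Integrable (fun q : E × (ℝ × E) => oseenKernel (t - q.2.1) (q.1 - q.2.2) (u q.2.1 q.2.2) (v q.2.1 q.2.2))
      ((volume : Measure E).prod ((volume : Measure (ℝ × E)).restrict (Ioo 0 t ×ˢ univ))) := by
  set μ : Measure (ℝ × E) := (volume : Measure (ℝ × E)).restrict (Ioo 0 t ×ˢ univ) with hμ
  obtain ⟨C, hC, hK⟩ := exists_lintegral_enorm_oseenKernel_le (E := E)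
  have hsub : Ioo (0 : ℝ) t ×ˢ (univ : Set E) ⊆ Ioi 0 ×ˢ univ := prod_mono Ioo_subset_Ioi_self subset_rfl
  have hu' : AEStronglyMeasurable (fun p : ℝ × E => u p.1 p.2) μ :=
    hu.mono_measure (Measure.restrict_mono hsub le_rfl)
  have hv' : AEStronglyMeasurable (fun p : ℝ × E => v p.1 p.2) μ :=
    hv.mono_measure (Measure.restrict_mono hsub le_rfl)
  have hFm : AEMeasurable (fun q : E × (ℝ × E) =>
      oseenKernel (t - q.2.1) (q.1 - q.2.2) (u q.2.1 q.2.2) (v q.2.1 q.2.2)) ((volume : Measure E).prod μ) := by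
    refine AEMeasurable.oseenKernel_comp ?_ ?_ ?_ ?_
    · exact (measurable_const.sub measurable_snd.fst).aemeasurable
    · exact (measurable_fst.sub measurable_snd.snd).aemeasurable
    · exact (hu'.comp_snd (μ := (volume : Measure E))).aemeasurable
    · exact (hv'.comp_snd (μ := (volume : Measure E))).aemeasurable
  refine ⟨hFm.aestronglyMeasurable, ?_⟩
  rw [hasFiniteIntegral_iff_enorm, lintegral_prod_symm _ hFm.enorm]
  -- the inner `x`-integral is the `L¹` size of the kernel
  have hinner : ∀ p : ℝ × E, p ∈ Ioo (0 : ℝ) t ×ˢ (univ : Set E) →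
      ∫⁻ x, ‖oseenKernel (t - p.1) (x - p.2) (u p.1 p.2) (v p.1 p.2)‖ₑ ≤
        ENNReal.ofReal (C * (t - p.1) ^ (-(1 / 2 : ℝ))) * ‖u p.1 p.2‖ₑ * ‖v p.1 p.2‖ₑ := by
    intro p hp
    rw [mem_prod] at hp
    have hτ : 0 < t - p.1 := sub_pos.2 hp.1.2
    rw [lintegral_sub_right_eq_self (fun z => ‖oseenKernel (t - p.1) z (u p.1 p.2) (v p.1 p.2)‖ₑ) p.2]
    exact (hK hτ (u p.1 p.2) (v p.1 p.2)).2
  calc ∫⁻ p, (∫⁻ x, ‖oseenKernel (t - p.1) (x - p.2) (u p.1 p.2) (v p.1 p.2)‖ₑ) ∂μ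
      ≤ ∫⁻ p, ENNReal.ofReal (C * (t - p.1) ^ (-(1 / 2 : ℝ))) * ‖u p.1 p.2‖ₑ * ‖v p.1 p.2‖ₑ ∂μ :=
        setLIntegral_mono' (measurableSet_Ioo.prod MeasurableSet.univ) hinner
    _ = ENNReal.ofReal C * ∫⁻ p, ENNReal.ofReal ((t - p.1) ^ (-(1 / 2 : ℝ))) *
          (‖u p.1 p.2‖ₑ * ‖v p.1 p.2‖ₑ) ∂μ := by
        rw [← lintegral_const_mul' _ _ ENNReal.ofReal_ne_top]
        refine lintegral_congr fun p => ?_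
        rw [ENNReal.ofReal_mul hC.le]
        ring
    _ < ∞ := ENNReal.mul_lt_top ENNReal.ofReal_lt_top hL1

/-- **Slices of `B(u, v)` are integrable** under the `L¹`-majorant condition (and finite
Koch–Tataru norms): `‖B(u,v)(t)‖_{L¹} ≤ ∫∫ ‖K(t-s, x-y)[u,v]‖ < ∞`. [cite: KochTataruAdvMath2001, §3 (14)] -/
theorem integrable_kochTataruBilinear_slice {u v : ℝ → E → E}
    (hu : AEStronglyMeasurable (uncurry u) ((volume : Measure (ℝ × E)).restrict (Ioi 0 ×ˢ univ)))
    (hv : AEStronglyMeasurable (uncurry v) ((volume : Measure (ℝ × E)).restrict (Ioi 0 ×ˢ univ)))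
    {t : ℝ}
    (hL1 : ∫⁻ p in Ioo 0 t ×ˢ univ, ENNReal.ofReal ((t - p.1) ^ (-(1 / 2 : ℝ))) *
      (‖u p.1 p.2‖ₑ * ‖v p.1 p.2‖ₑ) ∂(volume : Measure (ℝ × E)) < ∞) :
    Integrable (kochTataruBilinear u v t) := by
  have hprod := integrable_oseenKernel_prod hu hv hL1
  have h1 : Integrable (fun x => ∫ p in Ioo 0 t ×ˢ univ,
      oseenKernel (t - p.1) (x - p.2) (u p.1 p.2) (v p.1 p.2) ∂(volume : Measure (ℝ × E))) :=
    hprod.integral_prod_left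
  refine h1.congr ?_
  filter_upwards [hprod.prod_right_ae] with x hx
  unfold kochTataruBilinear
  rw [FluidPDE.volume_restrict_prod_univ_eq_prod] at hx ⊢
  exact integral_prod _ hx

end JointIntegrability

/-! ## The Fourier transform of a tested slice of `B(u, v)` -/

section FourierSlice

/-- **The Fourier transform of the slices of `B(u, v)`** (Koch–Tataru 2001, §2 (6)–(8) and §3
(11): `V∇Π` on the Fourier side is the multiplier `2πi ξ e^{-(2π)²(t-s)|ξ|²} P(ξ)` integrated in
time). For fields `u`, `v` measurable on `(0, ∞) × E` with finite Koch–Tataru norms and the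
`L¹`-majorant condition at time `t > 0`, and `w₀, ξ ∈ E`,
`𝓕 (x ↦ ⟪B(u,v)(t,x), w₀⟫)(ξ) = ∫_{(0,t) × E} e^{-2πi⟪y,ξ⟫} 2πi ⟪ξ, u(s,y)⟫ e^{-(2π)²(t-s)|ξ|²} ⟪P(ξ)v(s,y), w₀⟫ d(s,y)`:
the inner product passes through the absolutely convergent Duhamel integral, Fubini over
`E × ((0,t) × E)` (`integrable_oseenKernel_prod`), and the symbol of the translated kernel
(`fourier_inner_oseenKernel_comp_sub`). [cite: KochTataruAdvMath2001, §2 (6)–(8), §3 (11)] -/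
theorem fourier_inner_kochTataruBilinear_slice {u v : ℝ → E → E}
    (hu : AEStronglyMeasurable (uncurry u) ((volume : Measure (ℝ × E)).restrict (Ioi 0 ×ˢ univ)))
    (hv : AEStronglyMeasurable (uncurry v) ((volume : Measure (ℝ × E)).restrict (Ioi 0 ×ˢ univ)))
    (huX : eKochTataruNorm u < ∞) (hvX : eKochTataruNorm v < ∞) {t : ℝ} (ht : 0 < t)
    (hL1 : ∫⁻ p in Ioo 0 t ×ˢ univ, ENNReal.ofReal ((t - p.1) ^ (-(1 / 2 : ℝ))) *
      (‖u p.1 p.2‖ₑ * ‖v p.1 p.2‖ₑ) ∂(volume : Measure (ℝ × E)) < ∞)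
    (w₀ ξ : E) :
    𝓕 (fun x => ((⟪kochTataruBilinear u v t x, w₀⟫ : ℝ) : ℂ)) ξ =
      ∫ p in Ioo 0 t ×ˢ univ, 𝐞 (-⟪p.2, ξ⟫) •
        (2 * π * Complex.I * (⟪ξ, u p.1 p.2⟫ : ℝ) * (heatSymbol (t - p.1) ξ : ℝ) *
          (⟪leraySymbol ξ (v p.1 p.2), w₀⟫ : ℝ)) ∂(volume : Measure (ℝ × E)) := by
  set μ : Measure (ℝ × E) := (volume : Measure (ℝ × E)).restrict (Ioo 0 t ×ˢ univ) with hμ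
  set F : E → ℝ × E → E := fun x p => oseenKernel (t - p.1) (x - p.2) (u p.1 p.2) (v p.1 p.2) with hF
  have hprod := integrable_oseenKernel_prod hu hv hL1
  -- `B(u,v)(t,x)` as an integral over `(0,t) × E`, and the inner product through it
  have hB : ∀ x, kochTataruBilinear u v t x = ∫ p, F x p ∂μ := by
    intro x
    have hint := integrable_oseenKernel_duhamel hu hv huX hvX ht x
    rw [FluidPDE.volume_restrict_prod_univ_eq_prod] at hint
    rw [hμ, FluidPDE.volume_restrict_prod_univ_eq_prod, integral_prod _ hint]
    rfl
  have hinner : ∀ x, ((⟪kochTataruBilinear u v t x, w₀⟫ : ℝ) : ℂ) = ∫ p, ((⟪F x p, w₀⟫ : ℝ) : ℂ) ∂μ := by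
    intro x
    have hint := integrable_oseenKernel_duhamel hu hv huX hvX ht x
    rw [hB x, real_inner_comm, ← integral_inner hint w₀, ← integral_complex_ofReal]
    exact integral_congr_ae (Eventually.of_forall fun p => by simp only [hF, real_inner_comm])
  -- integrability of the Fourier integrand on `E × ((0,t) × E)`
  have hchar : Continuous fun q : E × (ℝ × E) => 𝐞 (-⟪q.1, ξ⟫) :=
    Real.continuous_fourierChar.comp (by fun_prop)
  have hG : Integrable (fun q : E × (ℝ × E) => ((⟪F q.1 q.2, w₀⟫ : ℝ) : ℂ))
      ((volume : Measure E).prod μ) := (hprod.inner_const w₀).ofReal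
  have hint : Integrable (uncurry fun x p => 𝐞 (-⟪x, ξ⟫) • ((⟪F x p, w₀⟫ : ℝ) : ℂ))
      ((volume : Measure E).prod μ) := by
    refine hG.norm.mono' (hchar.aestronglyMeasurable.smul hG.1) (Eventually.of_forall fun q => ?_)
    simp only [uncurry, Circle.norm_smul]
    exact le_rfl
  -- compute
  calc 𝓕 (fun x => ((⟪kochTataruBilinear u v t x, w₀⟫ : ℝ) : ℂ)) ξ
      = ∫ x, 𝐞 (-⟪x, ξ⟫) • ∫ p, ((⟪F x p, w₀⟫ : ℝ) : ℂ) ∂μ := by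
        rw [Real.fourier_eq]
        exact integral_congr_ae (Eventually.of_forall fun x => by beta_reduce; rw [hinner x])
    _ = ∫ x, (∫ p, 𝐞 (-⟪x, ξ⟫) • ((⟪F x p, w₀⟫ : ℝ) : ℂ) ∂μ) := by
        refine integral_congr_ae (Eventually.of_forall fun x => ?_)
        beta_reduce
        simp_rw [Circle.smul_def]
        exact (integral_smul _ _).symm
    _ = ∫ p, (∫ x, 𝐞 (-⟪x, ξ⟫) • ((⟪F x p, w₀⟫ : ℝ) : ℂ)) ∂μ := integral_integral_swap hint
    _ = ∫ p, 𝓕 (fun x => ((⟪F x p, w₀⟫ : ℝ) : ℂ)) ξ ∂μ := by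
        simp only [Real.fourier_eq]
    _ = _ := by
        rw [hμ]
        refine setIntegral_congr_fun (measurableSet_Ioo.prod MeasurableSet.univ) fun p hp => ?_
        rw [mem_prod] at hp
        exact fourier_inner_oseenKernel_comp_sub (sub_pos.2 hp.1.2) p.2 (u p.1 p.2) (v p.1 p.2) w₀ ξ

end FourierSlice

/-! ## The Fourier transform of a heat-potential slice -/

section HeatPotential

/-- **Joint integrability of the heat-potential integrand in `(x, (σ, y))`**: for `g` integrable on
`(0, s) × E`, `(x, (σ, y)) ↦ G_{s-σ}(x - y) g(σ, y)` is integrable on `E × ((0,s) × E)` (Tonelli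
and `∫ G_τ = 1`). [folklore] -/
theorem integrable_heatKernel_mul_prod {g : ℝ × E → ℝ} {s : ℝ}
    (hg : Integrable g ((volume : Measure (ℝ × E)).restrict (Ioo 0 s ×ˢ univ))) :
    Integrable (fun q : E × (ℝ × E) => heatKernel (s - q.2.1) (q.1 - q.2.2) * g q.2)
      ((volume : Measure E).prod ((volume : Measure (ℝ × E)).restrict (Ioo 0 s ×ˢ univ))) := by
  set μ : Measure (ℝ × E) := (volume : Measure (ℝ × E)).restrict (Ioo 0 s ×ˢ univ) with hμ
  have hGm : Measurable fun q : E × (ℝ × E) => heatKernel (s - q.2.1) (q.1 - q.2.2) :=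
    measurable_heatKernel_uncurry.comp
      ((measurable_const.sub measurable_snd.fst).prodMk (measurable_fst.sub measurable_snd.snd))
  have hFm : AEStronglyMeasurable (fun q : E × (ℝ × E) => heatKernel (s - q.2.1) (q.1 - q.2.2) * g q.2)
      ((volume : Measure E).prod μ) :=
    (hGm.aestronglyMeasurable).mul (hg.1.comp_snd (μ := (volume : Measure E)))
  refine ⟨hFm, ?_⟩
  rw [hasFiniteIntegral_iff_enorm, lintegral_prod_symm _ hFm.aemeasurable.enorm]
  have hinner : ∀ p : ℝ × E, p ∈ Ioo (0 : ℝ) s ×ˢ (univ : Set E) →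
      ∫⁻ x, ‖heatKernel (s - p.1) (x - p.2) * g p‖ₑ = ‖g p‖ₑ := by
    intro p hp
    rw [mem_prod] at hp
    have hτ : 0 < s - p.1 := sub_pos.2 hp.1.2
    simp_rw [enorm_mul]
    rw [lintegral_mul_const' _ _ enorm_ne_top,
      lintegral_sub_right_eq_self (fun z => ‖heatKernel (s - p.1) z‖ₑ) p.2,
      UnboundedOperators.lintegral_enorm_heatKernel hτ, one_mul]
  calc ∫⁻ p, (∫⁻ x, ‖heatKernel (s - p.1) (x - p.2) * g p‖ₑ) ∂μ
      = ∫⁻ p, ‖g p‖ₑ ∂μ := setLIntegral_congr_fun (measurableSet_Ioo.prod MeasurableSet.univ) hinner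
    _ < ∞ := hg.2

/-- **The Fourier transform of a heat potential slice**: for `g` integrable on `(0, s) × E`,
`𝓕 (x ↦ ∫_{(0,s) × E} G_{s-σ}(x - y) g(σ, y) d(σ,y))(ξ) = ∫_{(0,s) × E} e^{-2πi⟪y,ξ⟫} e^{-(2π)²(s-σ)|ξ|²} g(σ,y) d(σ,y)`
(Fubini and the Fourier transform of the translated Gaussian). This is `𝓕_x (Vg)(s, ξ) =
∫₀ˢ e^{-(2π)²(s-σ)|ξ|²} ĝ(σ, ξ) dσ`, the identification of the heat potential with the damped
primitive of Koch–Tataru's Step 4. [cite: KochTataruAdvMath2001, Lemma 3.2 Step 4 (16)] -/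
theorem fourier_heatPotential_slice {g : ℝ × E → ℝ} {s : ℝ}
    (hg : Integrable g ((volume : Measure (ℝ × E)).restrict (Ioo 0 s ×ˢ univ))) (ξ : E) :
    𝓕 (fun x => ((∫ p in Ioo 0 s ×ˢ univ, heatKernel (s - p.1) (x - p.2) * g p
        ∂(volume : Measure (ℝ × E)) : ℝ) : ℂ)) ξ =
      ∫ p in Ioo 0 s ×ˢ univ, 𝐞 (-⟪p.2, ξ⟫) • (((heatSymbol (s - p.1) ξ * g p : ℝ)) : ℂ)
        ∂(volume : Measure (ℝ × E)) := by
  set μ : Measure (ℝ × E) := (volume : Measure (ℝ × E)).restrict (Ioo 0 s ×ˢ univ) with hμ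
  have hprod := integrable_heatKernel_mul_prod hg
  have hchar : Continuous fun q : E × (ℝ × E) => 𝐞 (-⟪q.1, ξ⟫) :=
    Real.continuous_fourierChar.comp (by fun_prop)
  have hG : Integrable (fun q : E × (ℝ × E) => ((heatKernel (s - q.2.1) (q.1 - q.2.2) * g q.2 : ℝ) : ℂ))
      ((volume : Measure E).prod μ) := hprod.ofReal
  have hint : Integrable (uncurry fun x p =>
      𝐞 (-⟪x, ξ⟫) • ((heatKernel (s - p.1) (x - p.2) * g p : ℝ) : ℂ)) ((volume : Measure E).prod μ) := by
    refine hG.norm.mono' (hchar.aestronglyMeasurable.smul hG.1) (Eventually.of_forall fun q => ?_)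
    simp only [uncurry, Circle.norm_smul]
    exact le_rfl
  calc 𝓕 (fun x => ((∫ p, heatKernel (s - p.1) (x - p.2) * g p ∂μ : ℝ) : ℂ)) ξ
      = ∫ x, 𝐞 (-⟪x, ξ⟫) • ∫ p, ((heatKernel (s - p.1) (x - p.2) * g p : ℝ) : ℂ) ∂μ := by
        rw [Real.fourier_eq]
        refine integral_congr_ae (Eventually.of_forall fun x => ?_)
        beta_reduce
        rw [← integral_complex_ofReal]
    _ = ∫ x, (∫ p, 𝐞 (-⟪x, ξ⟫) • ((heatKernel (s - p.1) (x - p.2) * g p : ℝ) : ℂ) ∂μ) := by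
        refine integral_congr_ae (Eventually.of_forall fun x => ?_)
        beta_reduce
        simp_rw [Circle.smul_def]
        exact (integral_smul _ _).symm
    _ = ∫ p, (∫ x, 𝐞 (-⟪x, ξ⟫) • ((heatKernel (s - p.1) (x - p.2) * g p : ℝ) : ℂ)) ∂μ :=
        integral_integral_swap hint
    _ = ∫ p, (∫ x, 𝐞 (-⟪x, ξ⟫) • (heatKernel (s - p.1) (x - p.2) : ℂ)) * (g p : ℂ) ∂μ := by
        refine integral_congr_ae (Eventually.of_forall fun p => ?_)
        beta_reduce
        rw [← integral_mul_const]
        refine integral_congr_ae (Eventually.of_forall fun x => ?_)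
        beta_reduce
        simp only [Circle.smul_def, smul_eq_mul, Complex.ofReal_mul]
        ring
    _ = _ := by
        rw [hμ]
        refine setIntegral_congr_fun (measurableSet_Ioo.prod MeasurableSet.univ) fun p hp => ?_
        rw [mem_prod] at hp
        have h := fourier_heatKernel_comp_sub (sub_pos.2 hp.1.2) p.2 ξ
        rw [Real.fourier_eq] at h
        rw [h]
        simp only [Circle.smul_def, smul_eq_mul, Complex.ofReal_mul]
        ring

end HeatPotential


end Literature.Analysis.FluidPDE
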